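import Literature.AlgebraicGeometry.Resolution.TameCyclicToricDescent
import Literature.AlgebraicGeometry.Resolution.TameCyclicFixedModel
import Literature.AlgebraicGeometry.Resolution.CyclicInvariantsFiniteType
import HarnessLib

/-!
# The toric descent step for finitely generated models ([CoP1] Lemma 9.4, model currency)

Topic: `Literature/AlgebraicGeometry/Resolution`. PROOF side of `CossartPiltant2019ReductionP`
(`ArithmeticalThreefoldsLocal.lean`), input (C4). `TameCyclicToricDescent.lean` proves the toric
descent step for an abstract `σ`-stable regular local subring `B ⊆ O` and its ring of invariants
`A = B ∩ F^σ`, under the hypothesis that `A` is universally catenary. This file re-states it in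
the currency of local uniformization ([CoP1] §9; Cossart–Piltant 2019, (LU) and Prop. 4.10;
`CPLocalUniformization`, `hC4` of `cossartPiltant2019ReductionP_of_cjs_of_descent`): MODELS
`S[t] ⊆ O` finitely generated over a universally catenary (e.g. excellent) base ring `S` fixed by
`σ`, localised at the centre of `O`. Given a `σ`-STABLE model `S[t₀] ⊆ O` upstairs whose local
ring at the centre is regular of dimension `d` ("`S` is a local uniformization of `W` … stable
by `G`", HAL p. 29 — the stability is the open point (α) of the `CleanModels` memos), there is a
model `S[t] ⊆ O` generated by `σ`-FIXED elements whose local ring at the centre is regular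
("`R₁ := S₁^G` … is a local uniformization of `V/k`"): the ring of invariants of the local ring
upstairs is the local ring of the model `S[t₀]^σ = S[g]` (`TameCyclicFixedModel.lean`,
`CyclicInvariantsFiniteType.lean`), hence universally catenary, and the chart of
`exists_fixed_toricChart_isRegularLocalRing` over it is the local ring of `S[g, y]`.

* `exists_fixed_model_isRegularLocalRing` — PROVED.

Everything is PROVED; no named facts are introduced.

## Sources

* V. Cossart, O. Piltant, *Resolution of singularities of threefolds in positive characteristic.
  I*, J. Algebra 320 (2008) 1051–1082: proof of Lemma 9.4 (HAL hal-00139124, pp. 28–29).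
  [CossartPiltant2008]
* V. Cossart, O. Piltant, J. Algebra 529 (2019) 268–535: §4.1 (LU) and proof of Prop. 4.10.
  [CossartPiltant2019]
-/

noncomputable section

namespace Literature.AlgebraicGeometry.Resolution

universe u

open IsLocalRing

section Models

variable {F : Type u} [Field F] (O : ValuationSubring F)

/-- `((C)_𝔪[Y])_𝔪 = (C[Y])_𝔪`: localising at the centre before adjoining further elements of `O`
does not change the final local ring (Novacoski–Spivakovsky, Lemma 2.9; cf. `IsLocalBlowup.trans`).
[cite: NovacoskiSpivakovsky2014, Lemma 2.9] -/
private theorem locAtCentre_closure_locAtCentre_union (C : Subring F) (hCO : C ≤ O.toSubring)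
    (Y : Set F) (hY : Y ⊆ O) :
    locAtCentre (Subring.closure ((locAtCentre C O : Set F) ∪ Y)) O =
      locAtCentre (Subring.closure ((C : Set F) ∪ Y)) O := by
  have hCYO : Subring.closure ((C : Set F) ∪ Y) ≤ O.toSubring :=
    Subring.closure_le.mpr (Set.union_subset hCO hY)
  have hCC : C ≤ Subring.closure ((C : Set F) ∪ Y) := fun x hx => Subring.subset_closure (Or.inl hx)
  apply le_antisymm
  · have h1 : Subring.closure ((locAtCentre C O : Set F) ∪ Y) ≤
        locAtCentre (Subring.closure ((C : Set F) ∪ Y)) O := by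
      refine Subring.closure_le.mpr (Set.union_subset (locAtCentre_mono O hCC) ?_)
      intro x hx
      exact le_locAtCentre _ O (Subring.subset_closure (Or.inr hx))
    exact (locAtCentre_mono O h1).trans (locAtCentre_locAtCentre _ O).le
  · refine locAtCentre_mono O (Subring.closure_le.mpr ?_)
    rintro x (hx | hx)
    · exact Subring.subset_closure (Or.inl (le_locAtCentre _ O hx))
    · exact Subring.subset_closure (Or.inr hx)

/-- `closure (closure X ∪ Y) = closure (X ∪ Y)`. [folklore] -/
private theorem closure_closure_union (X Y : Set F) :
    Subring.closure ((Subring.closure X : Set F) ∪ Y) = Subring.closure (X ∪ Y) := by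
  apply le_antisymm
  · refine Subring.closure_le.mpr (Set.union_subset ?_ ?_)
    · exact Subring.closure_mono Set.subset_union_left
    · exact fun y hy => Subring.subset_closure (Or.inr hy)
  · refine Subring.closure_mono ?_
    rintro x (hx | hx)
    · exact Or.inl (Subring.subset_closure hx)
    · exact Or.inr hx

/-- **The toric descent step for models** ([CoP1] proof of Lemma 9.4, HAL pp. 28–29, toric
route; model currency of Cossart–Piltant's (LU)). Let `σ` be an automorphism of a field `F` with
`σ^ℓ = 1` and `σ O ⊆ O` for a valuation ring `O` of `F`; `S ⊆ F` a universally catenary subring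
fixed pointwise by `σ`, containing `ℓ⁻¹` and an `ℓ`-th root of unity `ζ` with `ζ^k - 1 ∈ S^×`
(`0 < k < ℓ`); `S[t₀] ⊆ O` a finitely generated model STABLE under `σ` whose local ring
`B = S[t₀]_{𝔪_O ∩ S[t₀]}` is REGULAR of dimension `d`, with `σ` residually trivial on `B` and the
residue field of `O` algebraic over that of `S` (polynomials with a unit coefficient). Then there
is a finite set `t ⊆ O` of `σ`-FIXED elements such that the local ring of the model `S[t]` at the
centre of `O` is a regular local ring. (`t` = generators of `S[t₀]^σ` together with the toric
chart `y` of `exists_fixed_toricChart_isRegularLocalRing` over `A = B ∩ F^σ = (S[t₀]^σ)_𝔪`.)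
[cite: CossartPiltant2008, proof of Lemma 9.4 (HAL pp. 28–29)]
[cite: CossartPiltant2019, Section 4.1 (LU) and proof of Prop. 4.10] -/
theorem exists_fixed_model_isRegularLocalRing (σ : F ≃+* F) (hσO : ∀ x ∈ O, σ x ∈ O)
    (S : Subring F) (hσS : ∀ s ∈ S, σ s = s) (hSuc : IsUniversallyCatenaryRing S)
    (t₀ : Finset F) (hT₀O : Subring.closure ((S : Set F) ∪ ↑t₀) ≤ O.toSubring)
    (hσT₀ : ∀ x ∈ Subring.closure ((S : Set F) ∪ ↑t₀), σ x ∈ Subring.closure ((S : Set F) ∪ ↑t₀))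
    (hBreg : IsRegularLocalRing (locAtCentre (Subring.closure ((S : Set F) ∪ ↑t₀)) O)) {d : ℕ}
    (hBdim : ringKrullDim (locAtCentre (Subring.closure ((S : Set F) ∪ ↑t₀)) O) = d)
    (hres : ∀ b ∈ locAtCentre (Subring.closure ((S : Set F) ∪ ↑t₀)) O, O.valuation (σ b - b) < 1)
    (halg : ∀ z : O, ∃ q : Polynomial S, (∃ i, IsUnit (q.coeff i)) ∧
      O.valuation (Polynomial.aeval (z : F) q) < 1)
    {ℓ : ℕ} (hℓ0 : ℓ ≠ 0) (hσℓ : σ ^ ℓ = 1) (hℓu : IsUnit ((ℓ : S)))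
    (ζ : F) (hζS : ζ ∈ S) (hζℓ : ζ ^ ℓ = 1)
    (hζu : ∀ k : ℕ, 0 < k → k < ℓ → IsUnit ((⟨ζ, hζS⟩ : S) ^ k - 1)) :
    ∃ t : Finset F, (∀ z ∈ t, σ z = z) ∧ Subring.closure ((S : Set F) ∪ ↑t) ≤ O.toSubring ∧
      IsRegularLocalRing (locAtCentre (Subring.closure ((S : Set F) ∪ ↑t)) O) := by
  classical
  set T₀ := Subring.closure ((S : Set F) ∪ ↑t₀) with hT₀
  set B := locAtCentre T₀ O with hB
  have hBO : B ≤ O.toSubring := locAtCentre_le hT₀O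
  have hST₀ : S ≤ T₀ := fun s hs => Subring.subset_closure (Or.inl hs)
  have hT₀B : T₀ ≤ B := le_locAtCentre T₀ O
  have hSB : S ≤ B := hST₀.trans hT₀B
  have hℓpos : 0 < ℓ := Nat.pos_of_ne_zero hℓ0
  haveI := hBreg
  -- powers of `σ`; `σ⁻¹ = σ^(ℓ-1)`
  have hσsymm : ∀ b : F, σ.symm b = (σ ^ (ℓ - 1)) b := fun b => by
    rw [RingEquiv.symm_apply_eq]
    change b = (σ * σ ^ (ℓ - 1)) b
    rw [← pow_succ', Nat.sub_add_cancel hℓpos, hσℓ]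
    rfl
  have hσpowT₀ : ∀ (k : ℕ) (b : F), b ∈ T₀ → (σ ^ k) b ∈ T₀ := by
    intro k
    induction k with
    | zero => intro b hb; exact hb
    | succ k ih => intro b hb; rw [pow_succ', RingAut.mul_apply]; exact hσT₀ _ (ih b hb)
  have hσT₀' : ∀ x ∈ T₀, σ.symm x ∈ T₀ := fun x hx => by rw [hσsymm]; exact hσpowT₀ _ x hx
  -- units of `O` stay units of `O`
  have hσunit : ∀ s ∈ O, O.valuation s = 1 → O.valuation (σ s) = 1 := by
    intro s hs hs1
    have hs0 : s ≠ 0 := ne_zero_of_valuation_eq_one hs1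
    refine le_antisymm ((O.valuation_le_one_iff _).mpr (hσO _ hs)) ?_
    have hsinv : s⁻¹ ∈ O := by rw [← O.valuation_le_one_iff, map_inv₀, hs1, inv_one]
    have h := (O.valuation_le_one_iff _).mpr (hσO _ hsinv)
    rw [map_inv₀, map_inv₀, inv_le_one₀ ((Valuation.pos_iff _).mpr
      (fun e => hs0 (by simpa using congrArg σ.symm e)))] at h
    exact h
  -- `B` is `σ`-stable
  have hσB : ∀ b ∈ B, σ b ∈ B := by
    intro b hb
    obtain ⟨y, hy, s, hs, hsv, rfl⟩ := mem_locAtCentre_iff.mp hb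
    exact mem_locAtCentre_iff.mpr ⟨σ y, hσT₀ y hy, σ s, hσT₀ s hs, hσunit s (hT₀O hs) hsv,
      map_div₀ σ y s⟩
  have hdomB : ∀ b : B, b ∈ maximalIdeal B ↔ O.valuation (b : F) < 1 :=
    mem_maximalIdeal_locAtCentre_iff hT₀O
  -- the fixed subring of `σ` and the ring of invariants `A = B ∩ F^σ`
  let Fix : Subring F :=
    { carrier := {x | σ x = x}
      mul_mem' := fun {a b} ha hb => by
        change σ (a * b) = a * b; rw [map_mul, ha, hb]
      one_mem' := map_one σ
      add_mem' := fun {a b} ha hb => by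
        change σ (a + b) = a + b; rw [map_add, ha, hb]
      zero_mem' := map_zero σ
      neg_mem' := fun {a} ha => by change σ (-a) = -a; rw [map_neg, ha] }
  have hFix : ∀ x : F, x ∈ Fix ↔ σ x = x := fun x => Iff.rfl
  let A : Subring F := B ⊓ Fix
  have hA : ∀ b, b ∈ A ↔ b ∈ B ∧ σ b = b := fun b => Subring.mem_inf
  have hAeq : A = locAtCentre (T₀ ⊓ Fix) O :=
    locAtCentre_inf_fixedSubring_eq σ hℓ0 hσℓ O hσO T₀ hσT₀ Fix hFix
  -- `T₁ = S[t₀]^σ` is finitely generated over `S`: `σ` as an `S`-algebra automorphism of `T₀`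
  set T₁ : Subring F := T₀ ⊓ Fix with hT₁
  have hT₁O : T₁ ≤ O.toSubring := fun x hx => hT₀O hx.1
  have hST₁ : S ≤ T₁ := fun s hs => ⟨hST₀ hs, hσS s hs⟩
  letI algST₀ : Algebra S T₀ := (Subring.inclusion hST₀).toAlgebra
  have halgST₀ : ∀ s : S, ((algebraMap S T₀ s : T₀) : F) = s := fun s => rfl
  haveI : Algebra.FiniteType S T₀ := by
    -- `T₀` is the image of the finitely generated `S`-algebra `S[t₀]`
    let f : Algebra.adjoin S (t₀ : Set F) →ₐ[S] T₀ :=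
      { toFun := fun x => ⟨(x : F), by
          have h : (x : F) ∈ (Algebra.adjoin S (t₀ : Set F)).toSubring := x.2
          rw [Algebra.adjoin_eq_ring_closure] at h
          refine (Subring.closure_le.mpr ?_ : _ ≤ T₀) h
          rintro z (⟨w, rfl⟩ | hz)
          · exact hST₀ w.2
          · exact Subring.subset_closure (Or.inr hz)⟩
        map_one' := rfl
        map_mul' := fun _ _ => rfl
        map_zero' := rfl
        map_add' := fun _ _ => rfl
        commutes' := fun _ => rfl }
    have hf : Function.Surjective f := by
      rintro ⟨z, hz⟩
      have hz' : z ∈ (Algebra.adjoin S (t₀ : Set F)).toSubring := by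
        rw [Algebra.adjoin_eq_ring_closure]
        refine (Subring.closure_le.mpr ?_ : T₀ ≤ _) hz
        rintro w (hw | hw)
        · exact Subring.subset_closure (Or.inl ⟨⟨w, hw⟩, rfl⟩)
        · exact Subring.subset_closure (Or.inr hw)
      exact ⟨⟨z, hz'⟩, rfl⟩
    haveI : Algebra.FiniteType S (Algebra.adjoin S (t₀ : Set F)) :=
      (Subalgebra.fg_iff_finiteType _).mp (Subalgebra.fg_adjoin_finset _)
    exact Algebra.FiniteType.of_surjective f hf
  let σT : T₀ ≃ₐ[S] T₀ :=
    { toFun := fun b => ⟨σ b, hσT₀ b b.2⟩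
      invFun := fun b => ⟨σ.symm b, hσT₀' b b.2⟩
      left_inv := fun b => Subtype.ext (σ.symm_apply_apply b)
      right_inv := fun b => Subtype.ext (σ.apply_symm_apply b)
      map_mul' := fun a b => Subtype.ext (map_mul σ (a : F) (b : F))
      map_add' := fun a b => Subtype.ext (map_add σ (a : F) (b : F))
      commutes' := fun s => Subtype.ext (hσS _ s.2) }
  have hσT_apply : ∀ b : T₀, ((σT b : T₀) : F) = σ b := fun b => rfl
  have hσTpow : ∀ (k : ℕ) (b : T₀), (((σT ^ k) b : T₀) : F) = (σ ^ k) (b : F) := by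
    intro k
    induction k with
    | zero => intro b; rfl
    | succ k ih =>
      intro b
      rw [pow_succ', AlgEquiv.mul_apply, pow_succ', RingAut.mul_apply, hσT_apply, ih]
  have hσTℓ : σT ^ ℓ = 1 := AlgEquiv.ext fun b => Subtype.ext (by rw [hσTpow, hσℓ]; rfl)
  let AT : Subalgebra S T₀ :=
    { (Fix.comap T₀.subtype) with
      algebraMap_mem' := fun s => show σ ((s : S) : F) = s from hσS _ s.2 }
  have hAT : ∀ c : T₀, c ∈ AT ↔ σT c = c := fun c => by
    change σ (c : F) = c ↔ _
    rw [Subtype.ext_iff, hσT_apply]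
  haveI : IsNoetherianRing S := hSuc.1
  have hATfg : AT.FG := fg_fixedSubalgebra_of_cyclic σT hℓ0 hσTℓ AT hAT
  obtain ⟨g, hg⟩ := hATfg
  -- generators of `T₁` in `F`
  let G₁ : Finset F := g.image (fun c : T₀ => (c : F))
  have hG₁fix : ∀ z ∈ G₁, σ z = z := by
    intro z hz
    obtain ⟨c, hc, rfl⟩ := Finset.mem_image.mp hz
    have : c ∈ AT := by rw [← hg]; exact Algebra.subset_adjoin hc
    exact this
  have hG₁T₀ : ∀ z ∈ G₁, z ∈ T₀ := by
    intro z hz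
    obtain ⟨c, -, rfl⟩ := Finset.mem_image.mp hz
    exact c.2
  have hT₁eq : T₁ = Subring.closure ((S : Set F) ∪ ↑G₁) := by
    apply le_antisymm
    · intro x hx
      have hxAT : (⟨x, hx.1⟩ : T₀) ∈ AT := hx.2
      rw [← hg] at hxAT
      -- induction on `S[g]`
      refine Algebra.adjoin_induction (p := fun (c : T₀) _ => (c : F) ∈
          Subring.closure ((S : Set F) ∪ ↑G₁)) ?_ ?_ ?_ ?_ hxAT
      · intro c hc
        exact Subring.subset_closure (Or.inr (Finset.mem_coe.mpr
          (Finset.mem_image.mpr ⟨c, hc, rfl⟩)))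
      · intro s
        exact Subring.subset_closure (Or.inl s.2)
      · intro a b _ _ ha hb
        exact Subring.add_mem _ ha hb
      · intro a b _ _ ha hb
        exact Subring.mul_mem _ ha hb
    · refine Subring.closure_le.mpr (Set.union_subset (fun s hs => hST₁ hs) ?_)
      intro z hz
      exact ⟨hG₁T₀ z hz, hG₁fix z hz⟩
  -- `A` is universally catenary
  have hAuc : IsUniversallyCatenaryRing A := by
    rw [hAeq, hT₁eq]
    exact isUniversallyCatenaryRing_locAtCentre_closure O S hSuc G₁ (hT₁eq ▸ hT₁O)
  -- hypotheses of the descent step on `B`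
  have hℓuB : IsUnit ((ℓ : B)) := by
    have h := hℓu.map (Subring.inclusion hSB)
    rwa [map_natCast] at h
  have hζB : ζ ∈ B := hSB hζS
  have hζuB : ∀ k : ℕ, 0 < k → k < ℓ → IsUnit ((⟨ζ, hζB⟩ : B) ^ k - 1) := by
    intro k hk hkℓ
    have h := (hζu k hk hkℓ).map (Subring.inclusion hSB)
    rw [map_sub, map_pow, map_one] at h
    exact h
  have halgB : ∀ z : O, ∃ q : Polynomial B, (∃ i, IsUnit (q.coeff i)) ∧
      O.valuation (Polynomial.aeval (z : F) q) < 1 := by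
    intro z
    obtain ⟨q, ⟨i, hi⟩, hqz⟩ := halg z
    refine ⟨q.map (Subring.inclusion hSB), ⟨i, ?_⟩, ?_⟩
    · rw [Polynomial.coeff_map]; exact hi.map _
    · rw [Polynomial.aeval_def, Polynomial.eval₂_map]
      rw [Polynomial.aeval_def] at hqz
      exact hqz
  -- the descent step
  obtain ⟨y, hσy, hyO, hreg⟩ := exists_fixed_toricChart_isRegularLocalRing O σ B hBO hσB hBreg
    hBdim hdomB halgB hℓ0 hσℓ hℓuB ζ hζB (hσS ζ hζS) hζℓ hζuB hres A hA hAuc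
  -- the model `S[g, y]`
  refine ⟨G₁ ∪ Finset.univ.image y, ?_, ?_, ?_⟩
  · intro z hz
    rcases Finset.mem_union.mp hz with hz | hz
    · exact hG₁fix z hz
    · obtain ⟨i, -, rfl⟩ := Finset.mem_image.mp hz
      exact hσy i
  · refine Subring.closure_le.mpr (Set.union_subset (fun s hs => hBO (hSB hs)) ?_)
    intro z hz
    rcases Finset.mem_union.mp (Finset.mem_coe.mp hz) with hz | hz
    · exact hT₀O (hG₁T₀ z hz)
    · obtain ⟨i, -, rfl⟩ := Finset.mem_image.mp hz
      exact hyO i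
  · have hyO' : Set.range y ⊆ O := by rintro _ ⟨i, rfl⟩; exact hyO i
    have hset : ((G₁ ∪ Finset.univ.image y : Finset F) : Set F) = (G₁ : Set F) ∪ Set.range y := by
      ext z
      simp only [Finset.coe_union, Set.mem_union, Finset.mem_coe, Finset.mem_image,
        Finset.mem_univ, true_and, Set.mem_range]
    have hkey : locAtCentre (Subring.closure ((A : Set F) ∪ Set.range y)) O =
        locAtCentre (Subring.closure ((S : Set F) ∪ ↑(G₁ ∪ Finset.univ.image y))) O := by
      rw [hAeq, hT₁eq, locAtCentre_closure_locAtCentre_union O _ (hT₁eq ▸ hT₁O) _ hyO',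
        closure_closure_union, hset, Set.union_assoc]
    rw [← hkey]
    exact hreg

end Models

end Literature.AlgebraicGeometry.Resolution

end
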